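import Literature.Analysis.FluidPDE.DeRosaPertTransportSummand
import HarnessLib

/-!
# De Rosa's perturbation stage: `‖D_t Z‖₀ ≲ δ_{q+1}^{1/2} τ_q⁻¹` (the transported potential)

Third file of the Calderón–Zygmund route to the transport error (plan in
`DeRosaPertTransportIdentity.lean`). From the per-summand envelope of
`DeRosaPertTransportSummand.lean`, the stage facts `DeRosa.gradPhiTransportBound`,
`DeRosa.tildeRTransportBound` (BDSV Prop. 5.9, arXiv (5.37)–(5.38), proved in
`DeRosaPertTransport.lean`) and "at most two cut-offs are active at any time" (§5.2 (iv)), we prove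
along the common prefix of the stage facts, at every INTERIOR time `t ∈ (0, T)` (where `D_t` of the
summands of inactive cut-offs vanishes):

  `‖D_t Z(t)‖₀ ≤ C δ_{q+1}^{1/2} τ_q⁻¹ λ_q^{α/2}`,  `‖∂_j D_t Z(t)‖₀ ≤ C δ_{q+1}^{1/2} τ_q⁻¹ λ_q^{α/2} λ_{q+1}`

(`DeRosa.transportZ_stageFact`; the harmless factor `λ_q^{α/2}` comes from the lower bound
`ρ_q ≥ δ_{q+1}λ_q^{-α}/8` of Lemma 5.4 entering `θ'`, `θ = (ρ_q/Σ∫η²)^{1/2}`). This is the quantitative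
form of BDSV §6.1.2 "`‖D_{t,q}(ρ_{q,i}^{1/2} a_k(R̃_{q,i}))‖_N ≲ δ_{q+1}^{1/2} τ_q⁻¹ ℓ^{-N}`" summed in the
potential rather than mode by mode.

## References

* L. De Rosa, Comm. PDE 44 (2019) 335–365 = arXiv:1801.10235, §5.5 Prop. 5.13 (`R̊^E`).
* T. Buckmaster, C. De Lellis, L. Székelyhidi Jr., V. Vicol, CPAM 72 (2019) = arXiv:1701.08678,
  §6.1.2 (arXiv (6.6)–(6.7)), Prop. 5.9, §5.2 (iv), Lemma 5.4.
-/

open MeasureTheory Set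
open scoped NNReal ENNReal ContDiff Matrix Matrix.Norms.Elementwise

noncomputable section

set_option maxSynthPendingDepth 3

namespace Literature.Analysis.FluidPDE

namespace DeRosa

open BDSV FunctionSpaces FunctionSpaces.Torus

/-- The flat three-torus `T³ = (ℝ/ℤ)³`, local notation. -/
local notation "𝕋³" => UnitAddTorus (Fin 3)

/-- Euclidean `ℝ³`, local notation. -/
local notation "ℝ³" => EuclideanSpace ℝ (Fin 3)

/-- The carrier `𝕃 = ℝ³ →L ℝ³`, local notation. -/
local notation "𝕃" => (EuclideanSpace ℝ (Fin 3) →L[ℝ] EuclideanSpace ℝ (Fin 3))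

/-! ## Arithmetic -/

section Arith

/-- **The bound on `θ'` in units of `δ^{1/2} τ⁻¹ Λ`** (`Λ = λ_q^{α/2}`): with `1 ≤ δW`, `W ≤ τ⁻¹`,
`ℓ^α ≤ 1`, `Θ' ≤ √2((1 + 6C_p²)/3 + 4K₁₀)/c₀² · δ^{1/2}τ⁻¹Λ`. [folklore] -/
theorem thetaDerivBound_le_unit {Cp c₀ δ W Ti E Λ K₁₀ : ℝ} (hCp : 0 ≤ Cp) (hc₀ : 0 < c₀) (hδ : 0 < δ)
    (hW0 : 0 ≤ W) (hTi : 0 < Ti) (hWT : W ≤ Ti) (hδW : 1 ≤ δ * W) (hE0 : 0 ≤ E) (hE1 : E ≤ 1)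
    (hΛ : 0 < Λ) (hK : 0 ≤ K₁₀) :
    ((1 + 6 * (Cp * (δ * E)) * (Cp * W)) / 3 + δ * (4 * (K₁₀ * Ti))) / c₀ ^ 2 /
        (2 * Real.sqrt (δ * (Λ⁻¹) ^ 2 / 8)) ≤
      Real.sqrt 2 * ((1 + 6 * Cp ^ 2) / 3 + 4 * K₁₀) / c₀ ^ 2 * (Real.sqrt δ * Ti * Λ) := by
  have hsδ : 0 < Real.sqrt δ := Real.sqrt_pos.2 hδ
  have hs8 : Real.sqrt 8 = 2 * Real.sqrt 2 := by
    rw [show (8 : ℝ) = 2 ^ 2 * 2 by norm_num, Real.sqrt_mul (by norm_num), Real.sqrt_sq (by norm_num)]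
  have hden : 2 * Real.sqrt (δ * (Λ⁻¹) ^ 2 / 8) = Real.sqrt δ * Λ⁻¹ / Real.sqrt 2 := by
    rw [Real.sqrt_div (by positivity), Real.sqrt_mul hδ.le, Real.sqrt_sq (inv_nonneg.2 hΛ.le), hs8]
    field_simp
  rw [hden]
  have hden0 : 0 < Real.sqrt δ * Λ⁻¹ / Real.sqrt 2 := by positivity
  -- the numerator
  have hnum : (1 + 6 * (Cp * (δ * E)) * (Cp * W)) / 3 + δ * (4 * (K₁₀ * Ti)) ≤
      δ * Ti * ((1 + 6 * Cp ^ 2) / 3 + 4 * K₁₀) := by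
    have h1 : (1 : ℝ) ≤ δ * Ti := hδW.trans (mul_le_mul_of_nonneg_left hWT hδ.le)
    have h2 : 6 * (Cp * (δ * E)) * (Cp * W) ≤ 6 * Cp ^ 2 * (δ * Ti) := by
      have : δ * E * W ≤ δ * 1 * Ti := by gcongr
      nlinarith [sq_nonneg Cp, mul_nonneg (mul_nonneg hδ.le hE0) hW0]
    nlinarith [mul_nonneg hδ.le hTi.le, h1, h2]
  have hnum0 : 0 ≤ (1 + 6 * (Cp * (δ * E)) * (Cp * W)) / 3 + δ * (4 * (K₁₀ * Ti)) := by positivity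
  rw [div_le_iff₀ hden0]
  calc ((1 + 6 * (Cp * (δ * E)) * (Cp * W)) / 3 + δ * (4 * (K₁₀ * Ti))) / c₀ ^ 2
      ≤ δ * Ti * ((1 + 6 * Cp ^ 2) / 3 + 4 * K₁₀) / c₀ ^ 2 := div_le_div_of_nonneg_right hnum (sq_nonneg _)
    _ = Real.sqrt 2 * ((1 + 6 * Cp ^ 2) / 3 + 4 * K₁₀) / c₀ ^ 2 * (Real.sqrt δ * Ti * Λ) *
          (Real.sqrt δ * Λ⁻¹ / Real.sqrt 2) := by
        have hΛ0 : Λ ≠ 0 := hΛ.ne'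
        have hs2 : Real.sqrt 2 ≠ 0 := (Real.sqrt_pos.2 (by norm_num)).ne'
        field_simp
        rw [Real.sq_sqrt hδ.le]

/-- **The total amplitude in units of `δ^{1/2} τ⁻¹ Λ`.** [folklore] -/
theorem totalAmp_le_unit {Θ σ₀ c₀ δ W Ti Λ K' Kη C₀a Cp CG CR KΘ : ℝ} (hc₀ : 0 < c₀) (hδ : 0 < δ)
    (hσ₀ : σ₀ = Real.sqrt (δ / c₀)) (hTi1 : 1 ≤ Ti) (hWT : W ≤ Ti) (hΛ1 : 1 ≤ Λ)
    (hK' : 0 ≤ K') (hKη : 0 ≤ Kη) (hC₀ : 0 ≤ C₀a) (hCp : 0 ≤ Cp) (hCG : 0 ≤ CG) (hCR : 0 ≤ CR)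
    (hΘ : Θ ≤ KΘ * (Real.sqrt δ * Ti * Λ)) :
    Θ + σ₀ * (K' * Ti + 2 * (C₀a + Cp * W) * Kη) + σ₀ * (CG * W + CR * Ti) ≤
      (KΘ + (K' + 2 * (C₀a + Cp) * Kη + CG + CR) / Real.sqrt c₀) * (Real.sqrt δ * Ti * Λ) := by
  have hsc : 0 < Real.sqrt c₀ := Real.sqrt_pos.2 hc₀
  have hσ₀' : σ₀ = Real.sqrt δ / Real.sqrt c₀ := by rw [hσ₀, Real.sqrt_div hδ.le]
  have hsδ : 0 ≤ Real.sqrt δ := Real.sqrt_nonneg _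
  have hTi0 : 0 ≤ Ti := zero_le_one.trans hTi1
  set V : ℝ := Real.sqrt δ * Ti * Λ with hV
  have hV0 : 0 ≤ V := by positivity
  -- `σ₀ X ≤ (X'/√c₀) V` for the various `X ≤ X' Ti`
  have key : ∀ {X X' : ℝ}, 0 ≤ X' → X ≤ X' * Ti → σ₀ * X ≤ X' / Real.sqrt c₀ * V := by
    intro X X' hX' hX
    rw [hσ₀', hV]
    have h1 : Real.sqrt δ / Real.sqrt c₀ * X ≤ Real.sqrt δ / Real.sqrt c₀ * (X' * Ti) :=
      mul_le_mul_of_nonneg_left hX (div_nonneg hsδ hsc.le)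
    refine h1.trans ?_
    rw [show Real.sqrt δ / Real.sqrt c₀ * (X' * Ti) = X' / Real.sqrt c₀ * (Real.sqrt δ * Ti * 1) by ring]
    gcongr
  have h1 : K' * Ti + 2 * (C₀a + Cp * W) * Kη ≤ (K' + 2 * (C₀a + Cp) * Kη) * Ti := by
    have : C₀a + Cp * W ≤ (C₀a + Cp) * Ti := by nlinarith
    nlinarith
  have h2 : CG * W + CR * Ti ≤ (CG + CR) * Ti := by nlinarith
  have e1 := key (by positivity) h1
  have e2 := key (by positivity) h2
  calc Θ + σ₀ * (K' * Ti + 2 * (C₀a + Cp * W) * Kη) + σ₀ * (CG * W + CR * Ti)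
      ≤ KΘ * V + (K' + 2 * (C₀a + Cp) * Kη) / Real.sqrt c₀ * V + (CG + CR) / Real.sqrt c₀ * V :=
        add_le_add (add_le_add hΘ e1) e2
    _ = (KΘ + (K' + 2 * (C₀a + Cp) * Kη + CG + CR) / Real.sqrt c₀) * V := by ring

end Arith

/-! ## The sum over the cut-offs -/

section Sum

variable {P : Params} {S : Setting} {Nbar : ℕ} {Cin C₀ c₀ : ℝ} {Cη : ℕ → ℕ → ℝ}

/-- `‖∂_j f(proj y)‖ ≤ ‖D(lift f)(y)‖`. [folklore] -/
theorem norm_partialDeriv_le_norm_iteratedFDeriv_one {F : Type*} [NormedAddCommGroup F] [NormedSpace ℝ F]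
    {f : 𝕋³ → F} (hf : IsContDiff 1 f) (j : Fin 3) (y : ℝ³) :
    ‖Torus.partialDeriv j f (proj y)‖ ≤ ‖iteratedFDeriv ℝ 1 (lift f) y‖ := by
  rw [partialDeriv_eq_fderiv_apply hf, ← fderiv_lift, norm_iteratedFDeriv_one_eq_norm_fderiv]
  refine (ContinuousLinearMap.le_opNorm _ _).trans ?_
  rw [PiLp.norm_single, norm_one, mul_one]

/-- **The order-one envelope of `lift(D_t Z(t))` at an interior time**: twice the per-summand
amplitude (at most two cut-offs are active, §5.2 (iv); the summands of inactive cut-offs have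
vanishing `D_t` at interior times). [cite: BuckmasterEtAl2018, §6.1.2 (arXiv (6.6)–(6.7)) and §5.2 (iv)] -/
theorem PerturbationData.hasEnvelope_lift_dtPotential (H : CoreHypotheses P S Nbar Cin C₀)
    (𝒟 : PerturbationData P S c₀ Cη) (h𝒮 : SmoothData P S 𝒟.cut.η 𝒟.D) (𝔚 : MikadoDatum mikadoRadius)
    (hNbar : 2 ≤ Nbar) (hc₀ : 0 < c₀) (hCin : 0 ≤ Cin) (ha : 1 ≤ P.a) (hb : 1 ≤ P.b) (hβ : 0 ≤ P.β) (hα : 0 ≤ P.α)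
    (h4 : 4 * amp P.β P.a P.b (S.q + 2) ≤ amp P.β P.a P.b (S.q + 1) * freq P.a P.b S.q ^ (-P.α))
    (hu : Cin * mollScale P.β P.α P.a P.b S.q ^ (2 * P.α) ≤ 1 / 2400)
    (hstr : 8 * ‖ofColsCL‖ * Cin * (freq P.a P.b S.q ^ P.α * mollScale P.β P.α P.a P.b S.q ^ P.α) ≤ 1)
    (h66 : (mollScale P.β P.α P.a P.b S.q)⁻¹ * (freq P.a P.b (S.q + 1))⁻¹ ≤ 1)
    {CV : ℝ} (hCV0 : 0 ≤ CV)
    (hCV : ∀ m ≤ 2, ∀ L ∈ Metric.closedBall (1 : 𝕃) (3 + 4 * ‖transposeCL‖), ∀ ξ : ℝ³,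
      ‖iteratedFDeriv ℝ m (mikadoLiftCL 𝔚.V) (L, ξ)‖ ≤ CV)
    {AG AR : ℝ} (hAG : 0 ≤ AG) (hAR : 0 ≤ AR) {t : ℝ} (ht : t ∈ Ioo 0 S.T)
    (hdA : ∀ i, t ∈ tildeInterval S.T (P.τ S.q) i →
      Torus.eContDiffHolderNorm 0 0 (advectiveDeriv S.T S.vbar (gradPhi 𝒟.D i) t) ≤ ENNReal.ofReal AG ∧
      Torus.eContDiffHolderNorm 1 0 (advectiveDeriv S.T S.vbar (gradPhi 𝒟.D i) t) ≤
        ENNReal.ofReal (AG * (mollScale P.β P.α P.a P.b S.q)⁻¹))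
    (hdR : ∀ i, t ∈ tildeInterval S.T (P.τ S.q) i →
      Torus.eContDiffHolderNorm 0 0 (advectiveDeriv S.T S.vbar (tildeR P S 𝒟.cut.η 𝒟.D i) t) ≤ ENNReal.ofReal AR ∧
      Torus.eContDiffHolderNorm 1 0 (advectiveDeriv S.T S.vbar (tildeR P S 𝒟.cut.η 𝒟.D i) t) ≤
        ENNReal.ofReal (AR * (mollScale P.β P.α P.a P.b S.q)⁻¹)) :
    HasEnvelope (lift (advectiveDeriv S.T S.vbar (potential P S 𝔚 𝒟.cut.η 𝒟.D) t)) 1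
      (2 * (dtSummandConst CV *
        (dSigmaAmp P S Cin C₀ c₀ Cη + Real.sqrt (amp P.β P.a P.b (S.q + 1) / c₀) * (AG + AR))))
      (2 * envFreq P S Cη) := by
  classical
  have ht' : t ∈ Icc 0 S.T := Ioo_subset_Icc_self ht
  have hτ : 0 < P.τ S.q := glueScale_pos ha S.q
  set A : ℝ := dtSummandConst CV *
    (dSigmaAmp P S Cin C₀ c₀ Cη + Real.sqrt (amp P.β P.a P.b (S.q + 1) / c₀) * (AG + AR)) with hA
  have hA0 : 0 ≤ A := mul_nonneg (dtSummandConst_nonneg hCV0)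
    (add_nonneg (dSigmaAmp_nonneg hCin ha) (mul_nonneg (Real.sqrt_nonneg _) (add_nonneg hAG hAR)))
  -- the frequency is at least one
  have hμ1 : 1 ≤ 2 * envFreq P S Cη := by
    have ha0 : 0 < P.a := by linarith
    have hn1 : (1 : ℝ) ≤ (P.freqNat (S.q + 1) : ℝ) := by
      exact_mod_cast Nat.one_le_iff_ne_zero.2 (Nat.pos_iff_ne_zero.1 (Nat.ceil_pos.2 (Real.rpow_pos_of_pos ha0 _)))
    have h1 : 1 ≤ envFreq P S Cη := by
      unfold envFreq
      have hF : (1 : ℝ) ≤ 2 * Real.pi * (32 * ‖transposeCL‖ + 3) + max (Cη 0 2) 0 + 1 := by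
        have h0 : 0 ≤ 2 * Real.pi * (32 * ‖transposeCL‖ + 3) :=
          mul_nonneg (mul_nonneg zero_le_two Real.pi_pos.le) (by positivity)
        linarith [le_max_right (Cη 0 2) 0]
      nlinarith
    linarith
  -- the amplitudes of the summands
  set Aseq : ℕ → ℝ := fun i => if (∀ x, 𝒟.cut.η i t x = 0) then 0 else A with hAseq
  have hsummand : ∀ i ∈ Finset.range (cutoffCount S.T (P.τ S.q)),
      HasEnvelope (lift (advectiveDeriv S.T S.vbar (potentialSummand P S 𝔚 𝒟.cut.η 𝒟.D i) t)) 1 (Aseq i)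
        (2 * envFreq P S Cη) := by
    intro i _
    by_cases hact : ∀ x, 𝒟.cut.η i t x = 0
    · have e : lift (advectiveDeriv S.T S.vbar (potentialSummand P S 𝔚 𝒟.cut.η 𝒟.D i) t) = fun _ => (0 : ℝ³) := by
        funext y
        rw [lift_apply]
        exact 𝒟.advectiveDeriv_potentialSummand_eq_zero h𝒮 𝔚 ht hact _
      rw [e, hAseq]
      simp only [hact, forall_const, if_true]
      exact HasEnvelope.zero 1 le_rfl hμ1
    · push Not at hact
      obtain ⟨x', hx'⟩ := hact
      have hwin : t ∈ tildeInterval S.T (P.τ S.q) i := 𝒟.cut.mem_tildeInterval ht' hx'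
      obtain ⟨hdA0, hdA1⟩ := hdA i hwin
      obtain ⟨hdR0, hdR1⟩ := hdR i hwin
      have h := 𝒟.hasEnvelope_lift_dtSummand H h𝒮 𝔚 hNbar hc₀ hCin ha hb hβ hα h4 hu hstr h66 hCV0 hCV hAG hAR
        ht' hx' hdA0 hdA1 hdR0 hdR1
      have hne : ¬ (∀ x, 𝒟.cut.η i t x = 0) := fun h' => hx' (h' x')
      rw [hAseq]
      simp only [hne, if_false]
      exact h
  -- the sum
  have hsum := HasEnvelope.sum (Finset.range (cutoffCount S.T (P.τ S.q))) hμ1 hsummand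
  have htwo : ∑ i ∈ Finset.range (cutoffCount S.T (P.τ S.q)), Aseq i ≤ 2 * A := by
    refine 𝒟.cut.sum_le_two_mul hτ t hA0 (fun i => ?_) (fun i hi => ?_) _
    · show (if (∀ x, 𝒟.cut.η i t x = 0) then 0 else A) ≤ A
      split_ifs
      · exact hA0
      · exact le_rfl
    · show (if (∀ x, 𝒟.cut.η i t x = 0) then 0 else A) = 0
      rw [if_pos hi]
  have e : lift (advectiveDeriv S.T S.vbar (potential P S 𝔚 𝒟.cut.η 𝒟.D) t) = fun y =>
      ∑ i ∈ Finset.range (cutoffCount S.T (P.τ S.q)),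
        lift (advectiveDeriv S.T S.vbar (potentialSummand P S 𝔚 𝒟.cut.η 𝒟.D i) t) y := by
    funext y
    rw [lift_apply, advectiveDeriv_potential h𝒮 𝔚 ht' (proj y)]
    rfl
  rw [e]
  exact hsum.mono le_rfl htwo

/-- From the envelope: pointwise bounds on `D_t Z(t)` and its first derivatives. [folklore] -/
theorem PerturbationData.dtPotential_bounds_of_envelope {𝔚 : MikadoDatum mikadoRadius}
    (𝒟 : PerturbationData P S c₀ Cη) (h𝒮 : SmoothData P S 𝒟.cut.η 𝒟.D) {t : ℝ} (ht : t ∈ Icc 0 S.T) {A μ : ℝ}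
    (h : HasEnvelope (lift (advectiveDeriv S.T S.vbar (potential P S 𝔚 𝒟.cut.η 𝒟.D) t)) 1 A μ) :
    (∀ x, ‖advectiveDeriv S.T S.vbar (potential P S 𝔚 𝒟.cut.η 𝒟.D) t x‖ ≤ A) ∧
      ∀ (j : Fin 3) x, ‖Torus.partialDeriv j (advectiveDeriv S.T S.vbar (potential P S 𝔚 𝒟.cut.η 𝒟.D) t) x‖ ≤
        A * μ := by
  have hU : UniqueDiffOn ℝ (Icc 0 S.T) := uniqueDiffOn_Icc h𝒮.pos_T
  have hZsm : Torus.IsSmoothSpaceTimeOn (Icc 0 S.T) (advectiveDeriv S.T S.vbar (potential P S 𝔚 𝒟.cut.η 𝒟.D)) :=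
    ((h𝒮.potential 𝔚).timeDerivWithin hU).add (h𝒮.vbar.convect (h𝒮.potential 𝔚) hU)
  have h1 : IsContDiff 1 (advectiveDeriv S.T S.vbar (potential P S 𝔚 𝒟.cut.η 𝒟.D) t) :=
    (hZsm.isSmooth_slice ht).isContDiff (by simp)
  refine ⟨fun x => ?_, fun j x => ?_⟩
  · obtain ⟨y, rfl⟩ := proj_surjective x
    have := h.norm_le₀ y
    rwa [lift_apply] at this
  · obtain ⟨y, rfl⟩ := proj_surjective x
    refine (norm_partialDeriv_le_norm_iteratedFDeriv_one h1 j y).trans ?_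
    have := h.norm_le (i := 1) le_rfl y
    rwa [pow_one] at this

end Sum

/-! ## The stage-shaped bound on `D_t Z` -/

section Stage

/-- The unit `δ_{q+1}^{1/2} τ_q⁻¹ λ_q^{α/2}` of the transport amplitudes. [folklore] -/
def transportUnit (P : Params) (S : Setting) : ℝ :=
  Real.sqrt (amp P.β P.a P.b (S.q + 1)) * (P.τ S.q)⁻¹ * freq P.a P.b S.q ^ (P.α / 2)

/-- `transportUnit ≥ 0` (`a ≥ 1`). [folklore] -/
theorem transportUnit_nonneg {P : Params} (ha : 1 ≤ P.a) (S : Setting) : 0 ≤ transportUnit P S :=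
  mul_nonneg (mul_nonneg (Real.sqrt_nonneg _) (inv_nonneg.2 (glueScale_pos ha _).le))
    (Real.rpow_nonneg (freq_pos ha _).le _)

/-- **The body of the `D_t Z` bound**: at interior times, `‖D_tZ(t)‖₀ ≤ C·unit` and
`‖∂_jD_tZ(t)‖₀ ≤ C·unit·λ_{q+1}`. [cite: BuckmasterEtAl2018, §6.1.2 (arXiv (6.6)–(6.7))] -/
def DtPotentialBound (𝔚 : MikadoDatum mikadoRadius) (P : Params) (C : ℝ) (S : Setting) (c₀ : ℝ)
    (Cη : ℕ → ℕ → ℝ) (𝒟 : PerturbationData P S c₀ Cη) : Prop :=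
  ∀ t ∈ Ioo 0 S.T,
    (∀ x, ‖advectiveDeriv S.T S.vbar (potential P S 𝔚 𝒟.cut.η 𝒟.D) t x‖ ≤ C * transportUnit P S) ∧
      ∀ (j : Fin 3) x, ‖Torus.partialDeriv j (advectiveDeriv S.T S.vbar (potential P S 𝔚 𝒟.cut.η 𝒟.D) t) x‖ ≤
        C * transportUnit P S * freq P.a P.b (S.q + 1)

/-- The body is monotone in the constant. [folklore] -/
theorem DtPotentialBound.mono {𝔚 : MikadoDatum mikadoRadius} {P : Params} {C C' : ℝ} {S : Setting} {c₀ : ℝ}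
    {Cη : ℕ → ℕ → ℝ} {𝒟 : PerturbationData P S c₀ Cη} (ha : 1 ≤ P.a) (hC : C ≤ C')
    (h : DtPotentialBound 𝔚 P C S c₀ Cη 𝒟) : DtPotentialBound 𝔚 P C' S c₀ Cη 𝒟 := by
  intro t ht
  obtain ⟨h0, h1⟩ := h t ht
  have hU := transportUnit_nonneg ha S
  have hf := (freq_pos (b := P.b) ha (S.q + 1)).le
  exact ⟨fun x => (h0 x).trans (mul_le_mul_of_nonneg_right hC hU),
    fun j x => (h1 j x).trans (mul_le_mul_of_nonneg_right (mul_le_mul_of_nonneg_right hC hU) hf)⟩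

/-- `λ_q^{-α} = (λ_q^{α/2})⁻²`. [folklore] -/
theorem freq_rpow_neg_eq_inv_sq {a b α : ℝ} (ha : 1 ≤ a) (q : ℕ) :
    freq a b q ^ (-α) = ((freq a b q ^ (α / 2))⁻¹) ^ 2 := by
  have hf := (freq_pos (b := b) ha q).le
  rw [← Real.rpow_neg hf, ← Real.rpow_natCast, ← Real.rpow_mul hf]
  congr 1
  push_cast
  ring

/-- `dSigmaAmp` unfolded for `C_in ≥ 0`. [folklore] -/
theorem dSigmaAmp_of_nonneg {P : Params} {S : Setting} {Cin C₀ c₀ : ℝ} {Cη : ℕ → ℕ → ℝ} (hCin : 0 ≤ Cin) :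
    dSigmaAmp P S Cin C₀ c₀ Cη = thetaDerivBound P S Cin c₀ Cη + Real.sqrt (amp P.β P.a P.b (S.q + 1) / c₀) *
      (max (max (Cη 1 0) (Cη 1 1)) 0 * (P.τ S.q)⁻¹ +
        2 * (|C₀| + Cin * (Real.sqrt (amp P.β P.a P.b S.q) * freq P.a P.b S.q)) * max (Cη 0 2) 0) := by
  unfold dSigmaAmp
  rw [abs_of_nonneg hCin]

/-- `thetaDerivBound` with `λ_q^{-α} = (λ_q^{α/2})⁻²`. [folklore] -/
theorem thetaDerivBound_eq_sq {P : Params} {S : Setting} {Cin c₀ : ℝ} {Cη : ℕ → ℕ → ℝ} (ha : 1 ≤ P.a) :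
    thetaDerivBound P S Cin c₀ Cη =
      ((1 + 6 * (Cin * (amp P.β P.a P.b (S.q + 1) * mollScale P.β P.α P.a P.b S.q ^ P.α)) *
            (Cin * (Real.sqrt (amp P.β P.a P.b S.q) * freq P.a P.b S.q))) / 3 +
          amp P.β P.a P.b (S.q + 1) * (4 * (max (Cη 1 0) 0 * (P.τ S.q)⁻¹))) / c₀ ^ 2 /
        (2 * Real.sqrt (amp P.β P.a P.b (S.q + 1) * ((freq P.a P.b S.q ^ (P.α / 2))⁻¹) ^ 2 / 8)) := by
  unfold thetaDerivBound
  rw [← freq_rpow_neg_eq_inv_sq ha]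

/-- `transportUnit` unfolded. [folklore] -/
theorem transportUnit_eq (P : Params) (S : Setting) :
    transportUnit P S = Real.sqrt (amp P.β P.a P.b (S.q + 1)) * (P.τ S.q)⁻¹ * freq P.a P.b S.q ^ (P.α / 2) := rfl

/-- `2 · envFreq = 2 F_c n_{q+1}`. [folklore] -/
theorem two_mul_envFreq (P : Params) (S : Setting) (Cη : ℕ → ℕ → ℝ) :
    2 * envFreq P S Cη = 2 * (2 * Real.pi * (32 * ‖transposeCL‖ + 3) + max (Cη 0 2) 0 + 1) * (P.freqNat (S.q + 1) : ℝ) := by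
  unfold envFreq; ring

/-- **`‖D_t Z(t)‖₀ ≤ C δ_{q+1}^{1/2} τ_q⁻¹ λ_q^{α/2}` and `‖∇D_t Z(t)‖₀ ≤ C δ_{q+1}^{1/2} τ_q⁻¹ λ_q^{α/2} λ_{q+1}` at
interior times, along the common prefix of the stage facts** (BDSV §6.1.2 in the curl form: the
transported Mikado phase, Prop. 5.9 for `D_t∇Φ_i`, `D_tR̃_{q,i}`, Lemma 5.3 for the cut-offs, two active
cut-offs). Thresholds: `α < min(α(5.37), α(5.38), βb(b-1), (1-β)(b-1)/3)`, `N̄ ≥ 2` and the `N̄` of the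
four instances `N = 0, 1` of (5.37), (5.38); `a` beyond their thresholds and those of
`4δ_{q+2} ≤ δ_{q+1}λ_q^{-α}`, `C_pℓ^{2α} ≤ 1/2400`, `8‖ofCols‖C_pλ_q^αℓ^α ≤ 1`, `ℓ⁻¹λ_{q+1}⁻¹ ≤ 1`, `δ_{q+1}⁻¹ ≤ δ_q^{1/2}λ_q`.
[cite: BuckmasterEtAl2018, §6.1.2 (arXiv (6.6)–(6.7)) with Prop. 5.9, Lemma 5.3, §5.2 (iv)] -/
theorem transportZ_stageFact : StageFact DtPotentialBound := by
  intro 𝔚 c₀ hc₀ Cη β hβ hβ3 b hb hbβ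
  have hb0 : 0 < b := by linarith
  have hb1 : 0 < b - 1 := by linarith
  have h1β : 0 < 1 - β := by linarith
  obtain ⟨α₁, hα₁, hGf⟩ := gradPhiTransportBound_holds c₀ hc₀ Cη β hβ hβ3 b hb hbβ
  obtain ⟨α₂, hα₂, hRf⟩ := tildeRTransportBound_holds c₀ hc₀ Cη β hβ hβ3 b hb hbβ
  refine ⟨min (min α₁ α₂) (min (β * b * (b - 1)) ((1 - β) * (b - 1) / 3)),
    lt_min (lt_min hα₁ hα₂) (lt_min (mul_pos (mul_pos hβ hb0) hb1) (div_pos (mul_pos h1β hb1) (by norm_num))),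
    fun α hα hαlt => ?_⟩
  have hαα₁ : α < α₁ := lt_of_lt_of_le hαlt ((min_le_left _ _).trans (min_le_left _ _))
  have hαα₂ : α < α₂ := lt_of_lt_of_le hαlt ((min_le_left _ _).trans (min_le_right _ _))
  have hαb : α < 2 * β * b * (b - 1) := by
    have := lt_of_lt_of_le hαlt ((min_le_right _ _).trans (min_le_left _ _)); nlinarith [mul_pos hβ hb0]
  have hα66 : 3 * α < 2 * (1 - β) * (b - 1) := by
    have := lt_of_lt_of_le hαlt ((min_le_right _ _).trans (min_le_right _ _)); nlinarith [mul_pos h1β hb1]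
  obtain ⟨NG0, hG0⟩ := hGf α hα hαα₁ 0
  obtain ⟨NG1, hG1⟩ := hGf α hα hαα₁ 1
  obtain ⟨NR0, hR0⟩ := hRf α hα hαα₂ 0
  obtain ⟨NR1, hR1⟩ := hRf α hα hαα₂ 1
  refine ⟨max 2 (max (max NG0 NG1) (max NR0 NR1)), fun Cin C₀ => ?_⟩
  set Cp : ℝ := max Cin 0 with hCp
  have hCp0 : 0 ≤ Cp := le_max_right _ _
  obtain ⟨CG0, aG0, haG0, hG0⟩ := hG0 Cp C₀
  obtain ⟨CG1, aG1, haG1, hG1⟩ := hG1 Cp C₀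
  obtain ⟨CR0, aR0, haR0, hR0⟩ := hR0 Cp C₀
  obtain ⟨CR1, aR1, haR1, hR1⟩ := hR1 Cp C₀
  -- the Mikado bound on the stress ball
  obtain ⟨CV, hCV0, hCV⟩ := exists_forall_le_norm_iteratedFDeriv_mikadoLiftCL_le 𝔚.contDiff_mikadoLift_V
    (isCompact_closedBall (1 : 𝕃) (3 + 4 * ‖transposeCL‖)) 2
  -- thresholds in `a`
  obtain ⟨a₁, ha₁, h4⟩ := exists_threshold_four_amp hb hαb
  obtain ⟨a₂, ha₂, hu⟩ := exists_threshold_mollScale_rpow_le hβ.le hb.le hα Cp (by norm_num : (0 : ℝ) < 1 / 2400)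
  obtain ⟨a₃, ha₃, hstr⟩ := exists_threshold_freq_mul_mollScale_rpow_le hβ.le hb.le hα (8 * ‖ofColsCL‖ * Cp) one_pos
  obtain ⟨a₅, ha₅, h66⟩ := exists_threshold_mollScale_inv_mul_freq_inv_le_one hb.le hα66
  obtain ⟨a₆, ha₆, hδW⟩ := exists_threshold_amp_succ_inv_le hβ hb hbβ
  -- constants
  set CG : ℝ := max (max CG0 CG1) 0 with hCG
  set CR : ℝ := max (max CR0 CR1) 0 with hCR
  set K₁₀ : ℝ := max (Cη 1 0) 0 with hK₁₀
  set Kη : ℝ := max (Cη 0 2) 0 with hKη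
  set K' : ℝ := max (max (Cη 1 0) (Cη 1 1)) 0 with hK'
  set KΘ : ℝ := Real.sqrt 2 * ((1 + 6 * Cp ^ 2) / 3 + 4 * K₁₀) / c₀ ^ 2 with hKΘ
  set Kfin : ℝ := KΘ + (K' + 2 * (|C₀| + Cp) * Kη + CG + CR) / Real.sqrt c₀ with hKfin
  set Fc : ℝ := 2 * Real.pi * (32 * ‖transposeCL‖ + 3) + max (Cη 0 2) 0 + 1 with hFc
  have hCG0 : 0 ≤ CG := le_max_right _ _
  have hCR0 : 0 ≤ CR := le_max_right _ _
  have hK₁₀0 : 0 ≤ K₁₀ := le_max_right _ _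
  have hKη0 : 0 ≤ Kη := le_max_right _ _
  have hK'0 : 0 ≤ K' := le_max_right _ _
  have hKΘ0 : 0 ≤ KΘ := by positivity
  have hKfin0 : 0 ≤ Kfin := by positivity
  have hFc1 : 1 ≤ Fc := by
    have h0 : 0 ≤ 2 * Real.pi * (32 * ‖transposeCL‖ + 3) :=
      mul_nonneg (mul_nonneg zero_le_two Real.pi_pos.le) (by positivity)
    rw [hFc]; linarith [le_max_right (Cη 0 2) 0]
  have hFc0 : 0 ≤ Fc := zero_le_one.trans hFc1
  have hdSC := dtSummandConst_nonneg hCV0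
  set C : ℝ := 2 * dtSummandConst CV * Kfin * (2 * Fc) with hC
  refine ⟨C, max (max (max a₁ a₂) (max a₃ a₅)) (max (max a₆ (max aG0 aG1)) (max aR0 aR1)),
    lt_max_of_lt_left (lt_max_of_lt_left (lt_max_of_lt_left ha₁)), fun a ha S H 𝒟 => ?_⟩
  have hA : max (max a₁ a₂) (max a₃ a₅) ≤ a := (le_max_left _ _).trans ha
  have hB : max (max a₆ (max aG0 aG1)) (max aR0 aR1) ≤ a := (le_max_right _ _).trans ha
  have haa₁ : a₁ ≤ a := ((le_max_left _ _).trans (le_max_left _ _)).trans hA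
  have haa₂ : a₂ ≤ a := ((le_max_right _ _).trans (le_max_left _ _)).trans hA
  have haa₃ : a₃ ≤ a := ((le_max_left _ _).trans (le_max_right _ _)).trans hA
  have haa₅ : a₅ ≤ a := ((le_max_right _ _).trans (le_max_right _ _)).trans hA
  have haa₆ : a₆ ≤ a := ((le_max_left _ _).trans (le_max_left _ _)).trans hB
  have haG0' : aG0 ≤ a := (((le_max_left _ _).trans (le_max_right _ _)).trans (le_max_left _ _)).trans hB
  have haG1' : aG1 ≤ a := (((le_max_right _ _).trans (le_max_right _ _)).trans (le_max_left _ _)).trans hB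
  have haR0' : aR0 ≤ a := ((le_max_left _ _).trans (le_max_right _ _)).trans hB
  have haR1' : aR1 ≤ a := ((le_max_right _ _).trans (le_max_right _ _)).trans hB
  have ha1 : (1 : ℝ) ≤ a := ha₁.le.trans haa₁
  have ha0 : (0 : ℝ) < a := by linarith
  -- the hypotheses at `Cp` and the instances of the facts
  have H' : CoreHypotheses ⟨β, α, a, b⟩ S (max 2 (max (max NG0 NG1) (max NR0 NR1))) Cp C₀ :=
    H.mono_const ha1 (le_max_left _ _)
  have hNbar2 : 2 ≤ max 2 (max (max NG0 NG1) (max NR0 NR1)) := le_max_left _ _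
  have HG0 := H'.of_le ((le_max_left _ _).trans ((le_max_left _ _).trans (le_max_right _ _)))
  have HG1 := H'.of_le ((le_max_right _ _).trans ((le_max_left _ _).trans (le_max_right _ _)))
  have HR0 := H'.of_le ((le_max_left _ _).trans ((le_max_right _ _).trans (le_max_right _ _)))
  have HR1 := H'.of_le ((le_max_right _ _).trans ((le_max_right _ _).trans (le_max_right _ _)))
  -- parameters at this `a`
  have h4' := h4 a haa₁ S.q
  have hu' := hu a haa₂ S.q
  have hstr' := hstr a haa₃ S.q
  have h66' := h66 a haa₅ S.q
  have hδW' := hδW a haa₆ S.q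
  set δ : ℝ := amp β a b (S.q + 1) with hδdef
  set W : ℝ := Real.sqrt (amp β a b S.q) * freq a b S.q with hW
  set ℓ : ℝ := mollScale β α a b S.q with hℓ
  set τ : ℝ := Params.τ ⟨β, α, a, b⟩ S.q with hτdef
  set Λ : ℝ := freq a b S.q ^ (α / 2) with hΛ
  set σ₀ : ℝ := Real.sqrt (amp β a b (S.q + 1) / c₀) with hσ₀
  have hδ0 : 0 < δ := amp_pos ha1 _
  have hW0 : 0 ≤ W := mul_nonneg (Real.sqrt_nonneg _) (freq_pos ha1 _).le
  have hℓ0 : 0 < ℓ := mollScale_pos ha1 _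
  have hℓ1 : ℓ ≤ 1 := mollScale_le_one_of_params ha1 hb.le hβ.le hα.le S.q
  have hτ0 : 0 < τ := glueScale_pos ha1 _
  have hτ1 : τ ≤ 1 := glueScale_le_one ha1 hb.le hβ.le (by linarith) hα.le S.q
  have hTi : 0 < τ⁻¹ := inv_pos.2 hτ0
  have hTi1 : 1 ≤ τ⁻¹ := one_le_inv_iff₀.2 ⟨hτ0, hτ1⟩
  have hΛ0 : 0 < Λ := Real.rpow_pos_of_pos (freq_pos ha1 _) _
  have hΛ1 : 1 ≤ Λ := Real.one_le_rpow (one_le_freq ha1 _) (by linarith)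
  -- `W ≤ τ⁻¹` (`τ = ℓ^{2α}/W`, `ℓ ≤ 1`)
  have hWT : W ≤ τ⁻¹ := by
    have e : τ = ℓ ^ (2 * α) / W := rfl
    have hWpos : 0 < W := mul_pos (Real.sqrt_pos.2 (amp_pos ha1 _)) (freq_pos ha1 _)
    rw [e, inv_div, le_div_iff₀ (Real.rpow_pos_of_pos hℓ0 _)]
    exact mul_le_of_le_one_right hWpos.le (Real.rpow_le_one hℓ0.le hℓ1 (by linarith))
  have hδW1 : 1 ≤ δ * W := by
    have h := mul_le_mul_of_nonneg_left hδW' hδ0.le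
    rwa [mul_inv_cancel₀ hδ0.ne'] at h
  -- smoothness (`ρ_q > 0`)
  have hρ : ∀ s ∈ Icc 0 S.T, 0 < rhoQ ⟨β, α, a, b⟩ S s := fun s hs => by
    have hpos : 0 < amp β a b (S.q + 1) * freq a b S.q ^ (-α) / 8 :=
      div_pos (mul_pos (amp_pos ha1 _) (Real.rpow_pos_of_pos (freq_pos ha1 _) _)) (by norm_num)
    exact hpos.trans_le (H'.le_rhoQ h4' hs)
  have h𝒮 : SmoothData ⟨β, α, a, b⟩ S 𝒟.cut.η 𝒟.D := H'.toSmoothData hc₀ 𝒟 hρ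
  intro t ht
  have ht' : t ∈ Icc 0 S.T := Ioo_subset_Icc_self ht
  -- the transport data from (5.37), (5.38)
  have hℓ0' : mollScale β α a b S.q ^ (-((0 : ℕ) : ℝ)) = 1 := by rw [Nat.cast_zero, neg_zero, Real.rpow_zero]
  have hℓ1' : mollScale β α a b S.q ^ (-((1 : ℕ) : ℝ)) = ℓ⁻¹ := by rw [Nat.cast_one, Real.rpow_neg_one]
  have hAG0 : 0 ≤ CG * W := mul_nonneg hCG0 hW0
  have hAR0 : 0 ≤ CR * τ⁻¹ := mul_nonneg hCR0 hTi.le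
  have hdA : ∀ i, t ∈ tildeInterval S.T τ i →
      Torus.eContDiffHolderNorm 0 0 (advectiveDeriv S.T S.vbar (gradPhi 𝒟.D i) t) ≤ ENNReal.ofReal (CG * W) ∧
      Torus.eContDiffHolderNorm 1 0 (advectiveDeriv S.T S.vbar (gradPhi 𝒟.D i) t) ≤
        ENNReal.ofReal (CG * W * ℓ⁻¹) := by
    intro i hwin
    have e0 := hG0 a haG0' S HG0 𝒟 i t hwin
    have e1 := hG1 a haG1' S HG1 𝒟 i t hwin
    rw [hℓ0', mul_one] at e0
    rw [hℓ1'] at e1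
    refine ⟨e0.trans (ENNReal.ofReal_le_ofReal ?_), e1.trans (ENNReal.ofReal_le_ofReal ?_)⟩
    · exact mul_le_mul_of_nonneg_right ((le_max_left _ _).trans (le_max_left _ _)) hW0
    · calc CG1 * (Real.sqrt (amp β a b S.q) * freq a b S.q * ℓ⁻¹) = CG1 * (W * ℓ⁻¹) := by rw [hW]
        _ ≤ CG * (W * ℓ⁻¹) := mul_le_mul_of_nonneg_right ((le_max_right _ _).trans (le_max_left _ _))
            (mul_nonneg hW0 (inv_nonneg.2 hℓ0.le))
        _ = CG * W * ℓ⁻¹ := by ring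
  have hdR : ∀ i, t ∈ tildeInterval S.T τ i →
      Torus.eContDiffHolderNorm 0 0 (advectiveDeriv S.T S.vbar (tildeR ⟨β, α, a, b⟩ S 𝒟.cut.η 𝒟.D i) t) ≤
        ENNReal.ofReal (CR * τ⁻¹) ∧
      Torus.eContDiffHolderNorm 1 0 (advectiveDeriv S.T S.vbar (tildeR ⟨β, α, a, b⟩ S 𝒟.cut.η 𝒟.D i) t) ≤
        ENNReal.ofReal (CR * τ⁻¹ * ℓ⁻¹) := by
    intro i hwin
    have e0 := hR0 a haR0' S HR0 𝒟 i t hwin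
    have e1 := hR1 a haR1' S HR1 𝒟 i t hwin
    rw [hℓ0', mul_one] at e0
    rw [hℓ1'] at e1
    refine ⟨e0.trans (ENNReal.ofReal_le_ofReal ?_), e1.trans (ENNReal.ofReal_le_ofReal ?_)⟩
    · exact mul_le_mul_of_nonneg_right ((le_max_left _ _).trans (le_max_left _ _)) hTi.le
    · calc CR1 * (τ⁻¹ * ℓ⁻¹) ≤ CR * (τ⁻¹ * ℓ⁻¹) :=
            mul_le_mul_of_nonneg_right ((le_max_right _ _).trans (le_max_left _ _))
              (mul_nonneg hTi.le (inv_nonneg.2 hℓ0.le))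
        _ = CR * τ⁻¹ * ℓ⁻¹ := by ring
  -- the envelope and the pointwise bounds
  have EZ := 𝒟.hasEnvelope_lift_dtPotential H' h𝒮 𝔚 hNbar2 hc₀ hCp0 ha1 hb.le hβ.le hα.le h4' hu' hstr' h66'
    hCV0 hCV hAG0 hAR0 ht hdA hdR
  obtain ⟨hp0, hp1⟩ := 𝒟.dtPotential_bounds_of_envelope h𝒮 ht' EZ
  -- the amplitude in units of `δ^{1/2} τ⁻¹ Λ`
  have hU : transportUnit ⟨β, α, a, b⟩ S = Real.sqrt δ * τ⁻¹ * Λ := transportUnit_eq _ _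
  have hΘ : thetaDerivBound ⟨β, α, a, b⟩ S Cp c₀ Cη ≤ KΘ * (Real.sqrt δ * τ⁻¹ * Λ) := by
    have h := thetaDerivBound_le_unit (E := ℓ ^ α) (K₁₀ := K₁₀) hCp0 hc₀ hδ0 hW0 hTi hWT hδW1
      (Real.rpow_nonneg hℓ0.le _) (Real.rpow_le_one hℓ0.le hℓ1 hα.le) hΛ0 hK₁₀0
    rw [thetaDerivBound_eq_sq (P := ⟨β, α, a, b⟩) ha1, hKΘ]
    exact h
  have hAmp : dSigmaAmp ⟨β, α, a, b⟩ S Cp C₀ c₀ Cη + σ₀ * (CG * W + CR * τ⁻¹) ≤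
      Kfin * (Real.sqrt δ * τ⁻¹ * Λ) := by
    have h := totalAmp_le_unit (Θ := thetaDerivBound ⟨β, α, a, b⟩ S Cp c₀ Cη) (K' := K') (Kη := Kη)
      (C₀a := |C₀|) (CG := CG) (CR := CR) hc₀ hδ0 hσ₀ hTi1 hWT hΛ1 hK'0 hKη0 (abs_nonneg _) hCp0 hCG0 hCR0 hΘ
    rw [dSigmaAmp_of_nonneg (P := ⟨β, α, a, b⟩) hCp0, hKfin]
    exact h
  have hAtot : 2 * (dtSummandConst CV * (dSigmaAmp ⟨β, α, a, b⟩ S Cp C₀ c₀ Cη + σ₀ * (CG * W + CR * τ⁻¹))) ≤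
      2 * dtSummandConst CV * Kfin * (Real.sqrt δ * τ⁻¹ * Λ) := by
    have h := mul_le_mul_of_nonneg_left hAmp hdSC
    calc 2 * (dtSummandConst CV * (dSigmaAmp ⟨β, α, a, b⟩ S Cp C₀ c₀ Cη + σ₀ * (CG * W + CR * τ⁻¹)))
        ≤ 2 * (dtSummandConst CV * (Kfin * (Real.sqrt δ * τ⁻¹ * Λ))) := by linarith
      _ = 2 * dtSummandConst CV * Kfin * (Real.sqrt δ * τ⁻¹ * Λ) := by ring
  have hUnit0 : 0 ≤ Real.sqrt δ * τ⁻¹ * Λ := mul_nonneg (mul_nonneg (Real.sqrt_nonneg _) hTi.le) hΛ0.le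
  have hbase0 : 0 ≤ 2 * dtSummandConst CV * Kfin := mul_nonneg (mul_nonneg zero_le_two hdSC) hKfin0
  -- `n ≤ λ_{q+1}` and `2·envFreq = 2 Fc n`
  have hfreq : freq a b (S.q + 1) = 2 * Real.pi * (Params.freqNat ⟨β, α, a, b⟩ (S.q + 1) : ℝ) :=
    Params.freq_eq ⟨β, α, a, b⟩ ha0.le (S.q + 1)
  have hn0 : (0 : ℝ) ≤ (Params.freqNat ⟨β, α, a, b⟩ (S.q + 1) : ℝ) := Nat.cast_nonneg _
  have hnfreq : (Params.freqNat ⟨β, α, a, b⟩ (S.q + 1) : ℝ) ≤ freq a b (S.q + 1) := by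
    rw [hfreq]
    have hπ : (1 : ℝ) ≤ 2 * Real.pi := by linarith [Real.pi_gt_three]
    exact le_mul_of_one_le_left hn0 hπ
  have henv : 2 * envFreq ⟨β, α, a, b⟩ S Cη = 2 * Fc * (Params.freqNat ⟨β, α, a, b⟩ (S.q + 1) : ℝ) := by
    rw [two_mul_envFreq, hFc]
  refine ⟨fun x => (hp0 x).trans ?_, fun j x => (hp1 j x).trans ?_⟩
  · rw [hU, hC]
    refine hAtot.trans ?_
    have h2 : (1 : ℝ) ≤ 2 * Fc := by linarith
    calc 2 * dtSummandConst CV * Kfin * (Real.sqrt δ * τ⁻¹ * Λ)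
        = 2 * dtSummandConst CV * Kfin * 1 * (Real.sqrt δ * τ⁻¹ * Λ) := by ring
      _ ≤ 2 * dtSummandConst CV * Kfin * (2 * Fc) * (Real.sqrt δ * τ⁻¹ * Λ) :=
          mul_le_mul_of_nonneg_right (mul_le_mul_of_nonneg_left h2 hbase0) hUnit0
  · rw [hU, hC, henv]
    calc 2 * (dtSummandConst CV * (dSigmaAmp ⟨β, α, a, b⟩ S Cp C₀ c₀ Cη + σ₀ * (CG * W + CR * τ⁻¹))) *
          (2 * Fc * (Params.freqNat ⟨β, α, a, b⟩ (S.q + 1) : ℝ))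
        ≤ 2 * dtSummandConst CV * Kfin * (Real.sqrt δ * τ⁻¹ * Λ) * (2 * Fc * (Params.freqNat ⟨β, α, a, b⟩ (S.q + 1) : ℝ)) :=
          mul_le_mul_of_nonneg_right hAtot (mul_nonneg (mul_nonneg zero_le_two hFc0) hn0)
      _ = 2 * dtSummandConst CV * Kfin * (2 * Fc) * (Real.sqrt δ * τ⁻¹ * Λ) * (Params.freqNat ⟨β, α, a, b⟩ (S.q + 1) : ℝ) := by
          ring
      _ ≤ 2 * dtSummandConst CV * Kfin * (2 * Fc) * (Real.sqrt δ * τ⁻¹ * Λ) * freq a b (S.q + 1) :=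
          mul_le_mul_of_nonneg_left hnfreq (mul_nonneg (mul_nonneg hbase0 (mul_nonneg zero_le_two hFc0)) hUnit0)

end Stage

end DeRosa

end Literature.Analysis.FluidPDE
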